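import Mathlib
import Literature.Analysis.Complex.ArgumentPrincipleWinding
import HarnessLib

/-!
# Darboux's theorem: boundary values winding once around a convex set

Classical univalence criterion ("Darboux's theorem"; Boas, *Invitation to Complex Analysis*,
2nd ed. (2010) §13D; Pommerenke, *Boundary Behaviour of Conformal Maps* (1992) Ch. 2; the engine
is the argument principle, Conway Ch. V Thm 3.4), in the winding-number language of the tree
(`Literature.Topology.PlaneTopology.wind`, `circleLoop`):

* `darbouxPicard_convex` — `Φ` holomorphic on the unit disc and continuous on the closed disc,
  `K` compact convex, `w₀ ∈ interior K`; if the boundary values `Φ(e^{it})`, `t ∈ [0, 2π]`, lie on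
  `frontier K` and admit a continuous argument `θ` about `w₀` with `θ(2π) = θ(0) + 2π` (the trace
  winds ONCE about `w₀`), then `Φ` is injective on the disc and maps it onto `interior K`
  (no monotonicity of `θ` is needed);
* `traceWinding_nonneg` — a continuous argument `θ` of `Φ(e^{it}) - w₀` (`w₀` omitted by the
  boundary values) satisfies `θ(0) ≤ θ(2π)`: a holomorphic boundary trace never winds negatively.

Proof. `θ(2π) - θ(0) = 2π · wind (Φ ∘ γ₁ - w₀)` for the unit circle `γ₁` (`sub_eq_two_pi_mul_wind`);
by uniform continuity the circles `γ_r`, `r → 1`, give loops `Φ ∘ γ_r - w` with the same winding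
number and no zero of `Φ - w` on `‖z‖ = r` (`exists_radius_wind_eq`); the argument principle
(`wind_circleLoop_nonneg`, `wind_circleLoop_pos_of_zero`, and `ArgPrinciple.factorisation` /
`wind_eq_sum` for the count `= 1`, `exists_unique_zero_of_wind_eq_one`) turns winding numbers into
zero counts (`zeros_of_boundary_wind`). The boundary trace winds `1` about every point of
`interior K` (a connected set missing the trace, `wind_sub_eq_of_mem_interior`) and `0` about every
point off `K` (escape along a ray, `wind_sub_eq_zero_of_not_mem`); so `Φ - w` has exactly one zero
in the disc for `w ∈ interior K` and none for `w ∉ K`, and the open mapping theorem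
(`AnalyticOnNhd.is_constant_or_isOpen`) puts the open set `Φ(disc) ⊆ K` inside `interior K`.
Written for the line `potential-darboux-picard-diamond` of crux `ParafermionToSLESixFamilies`
(summit `CriticalPhenomena/CardyFormulaZ2`); no lattice objects here.

## References

* R. P. Boas, *Invitation to Complex Analysis*, 2nd ed., rev. H. P. Boas, MAA (2010), §13D
  ("Darboux's theorem"). [Boas2010]
* J. B. Conway, *Functions of One Complex Variable I*, 2nd ed. (1978), Ch. V §3 Thm 3.4
  (argument principle), Ch. IV §7 (open mapping theorem). [Conway1978]
-/

noncomputable section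

open Set Metric Filter
open scoped Real Topology
open Literature.Topology.PlaneTopology

namespace Literature.Analysis.Complex

open _root_.Complex

/-! ### The boundary circle and the argument of the boundary trace -/

/-- The unit circle loop is `s ↦ e^{2πis}`, in the `exp (t * I)` form (`t : ℝ`). [folklore] -/
theorem circleLoop_zero_one (s : ℝ) : circleLoop 0 1 s = exp ((2 * π * s : ℝ) * I) := by
  simp [circleLoop, circleMap]

/-- Circle loops of radius `r ∈ [0, 1]` about `0` lie in the closed unit disc. [folklore] -/
theorem circleLoop_mem_closedBall {r : ℝ} (hr : 0 ≤ r) (hr1 : r ≤ 1) (s : ℝ) :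
    circleLoop 0 r s ∈ closedBall (0 : ℂ) 1 :=
  closedBall_subset_closedBall hr1 (sphere_subset_closedBall (circleLoop_mem_sphere 0 hr s))

/-- `[0, 1] ∋ s ↦ 2πs ∈ [0, 2π]`. [folklore] -/
theorem two_pi_mul_mem_Icc {s : ℝ} (hs : s ∈ Icc (0 : ℝ) 1) : 2 * π * s ∈ Icc (0 : ℝ) (2 * π) :=
  ⟨mul_nonneg Real.two_pi_pos.le hs.1, mul_le_of_le_one_right Real.two_pi_pos.le hs.2⟩

/-- **The argument increment is `2π` times the winding number.** If `θ` is a continuous argument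
of `Φ(e^{it}) - w₀` on `[0, 2π]` (`Φ` continuous on the closed unit disc, `w₀` omitted by the
boundary values), then `θ(2π) - θ(0) = 2π · wind (s ↦ Φ(e^{2πis}) - w₀)`. [folklore] -/
theorem sub_eq_two_pi_mul_wind {Φ : ℂ → ℂ} {w₀ : ℂ} {θ : ℝ → ℝ}
    (hΦ : ContinuousOn Φ (closedBall (0 : ℂ) 1)) (hθ : ContinuousOn θ (Icc (0 : ℝ) (2 * π)))
    (hne : ∀ t ∈ Icc (0 : ℝ) (2 * π), Φ (exp (t * I)) ≠ w₀)
    (hpol : ∀ t ∈ Icc (0 : ℝ) (2 * π),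
      Φ (exp (t * I)) - w₀ = (‖Φ (exp (t * I)) - w₀‖ : ℂ) * exp (θ t * I)) :
    θ (2 * π) - θ 0 = 2 * π * (wind (fun s => Φ (circleLoop 0 1 s) - w₀) : ℝ) := by
  -- the loop and its explicit logarithm `log ‖G‖ + i θ(2π s)`
  have hG : ContinuousOn (fun s : ℝ => Φ (circleLoop 0 1 s) - w₀) (Icc 0 1) :=
    (hΦ.comp (continuous_circleLoop 0 1).continuousOn
      fun s _ => circleLoop_mem_closedBall zero_le_one le_rfl s).sub continuousOn_const
  have hG0 : ∀ s ∈ Icc (0 : ℝ) 1, Φ (circleLoop 0 1 s) - w₀ ≠ 0 := fun s hs => by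
    rw [circleLoop_zero_one]; exact sub_ne_zero.2 (hne _ (two_pi_mul_mem_Icc hs))
  have hθ' : ContinuousOn (fun s : ℝ => θ (2 * π * s)) (Icc 0 1) :=
    hθ.comp (by fun_prop) fun s hs => two_pi_mul_mem_Icc hs
  set l : ℝ → ℂ := fun s => (Real.log ‖Φ (circleLoop 0 1 s) - w₀‖ : ℂ) + θ (2 * π * s) * I
    with hl
  have hlc : ContinuousOn l (Icc 0 1) :=
    (continuous_ofReal.comp_continuousOn
      (hG.norm.log fun s hs => (norm_pos_iff.2 (hG0 s hs)).ne')).add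
      ((continuous_ofReal.comp_continuousOn hθ').mul continuousOn_const)
  have hle : ∀ s ∈ Icc (0 : ℝ) 1, exp (l s) = Φ (circleLoop 0 1 s) - w₀ := by
    intro s hs
    simp only [hl]
    rw [exp_add, ← ofReal_exp, Real.exp_log (norm_pos_iff.2 (hG0 s hs)), circleLoop_zero_one]
    exact (hpol _ (two_pi_mul_mem_Icc hs)).symm
  have h01 : Φ (circleLoop 0 1 0) - w₀ = Φ (circleLoop 0 1 1) - w₀ := by rw [circleLoop_zero_eq]
  have hspec := wind_spec (f := fun s => Φ (circleLoop 0 1 s) - w₀) hlc hle h01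
  -- read off the imaginary increment
  have key : ((θ (2 * π) - θ 0 : ℝ) : ℂ) * I =
      (wind (fun s => Φ (circleLoop 0 1 s) - w₀) : ℂ) * (2 * π) * I := by
    rw [mul_assoc, ← hspec]
    simp only [hl, circleLoop_zero_eq, mul_one, mul_zero]
    push_cast
    ring
  have key' := mul_right_cancel₀ I_ne_zero key
  apply ofReal_injective
  rw [key']
  push_cast
  ring

/-! ### Shrinking the circle: radii close to `1` -/

/-- **Circles near the boundary carry the boundary winding number.** If `Φ` is continuous on the
closed unit disc and its boundary values omit `w`, then for all radii `r < 1` close to `1` the loop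
`s ↦ Φ(r e^{2πis}) - w` has the same winding number as the boundary loop, and `Φ ≠ w` on the circle
`‖z‖ = r` (uniform continuity and Rouché for loops). [folklore] -/
theorem exists_radius_wind_eq {Φ : ℂ → ℂ} (hΦ : ContinuousOn Φ (closedBall (0 : ℂ) 1)) {w : ℂ}
    (hw : ∀ s ∈ Icc (0 : ℝ) 1, Φ (circleLoop 0 1 s) ≠ w) :
    ∃ r₀ ∈ Ico (0 : ℝ) 1, ∀ r ∈ Ioo r₀ 1,
      wind (fun s => Φ (circleLoop 0 r s) - w) = wind (fun s => Φ (circleLoop 0 1 s) - w) ∧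
      ∀ u : ℂ, ‖u‖ = r → Φ u ≠ w := by
  have hΓc : ContinuousOn (fun s : ℝ => Φ (circleLoop 0 1 s) - w) (Icc 0 1) :=
    (hΦ.comp (continuous_circleLoop 0 1).continuousOn
      fun s _ => circleLoop_mem_closedBall zero_le_one le_rfl s).sub continuousOn_const
  -- positive minimum of `‖Φ ∘ γ₁ - w‖`
  obtain ⟨m, hm, hmle⟩ : ∃ m > 0, ∀ s ∈ Icc (0 : ℝ) 1, m ≤ ‖Φ (circleLoop 0 1 s) - w‖ := by
    obtain ⟨s₀, hs₀, hmin⟩ :=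
      isCompact_Icc.exists_isMinOn (nonempty_Icc.2 (zero_le_one' ℝ)) hΓc.norm
    exact ⟨‖Φ (circleLoop 0 1 s₀) - w‖, norm_pos_iff.2 (sub_ne_zero.2 (hw s₀ hs₀)),
      fun s hs => isMinOn_iff.1 hmin s hs⟩
  -- uniform continuity of `Φ` on the closed disc
  obtain ⟨δ, hδ, hU⟩ := Metric.uniformContinuousOn_iff.1
    ((isCompact_closedBall (0 : ℂ) 1).uniformContinuousOn_of_continuous hΦ) m hm
  refine ⟨max 0 (1 - δ), ⟨le_max_left _ _, max_lt one_pos (by linarith)⟩, fun r hr => ?_⟩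
  have hr0 : 0 < r := lt_of_le_of_lt (le_max_left _ _) hr.1
  have hr1 : r < 1 := hr.2
  have hrδ : 1 - δ < r := lt_of_le_of_lt (le_max_right _ _) hr.1
  have hclose : ∀ s, ‖Φ (circleLoop 0 r s) - Φ (circleLoop 0 1 s)‖ < m := by
    intro s
    rw [← dist_eq_norm]
    refine hU _ (circleLoop_mem_closedBall hr0.le hr1.le s) _
      (circleLoop_mem_closedBall zero_le_one le_rfl s) ?_
    have e : circleLoop 0 r s - circleLoop 0 1 s =
        ((r - 1 : ℝ) : ℂ) * exp ((2 * π * s : ℝ) * I) := by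
      rw [circleLoop_apply, circleLoop_apply]; push_cast; ring
    rw [dist_eq_norm, e, norm_mul, norm_exp_ofReal_mul_I, mul_one, norm_real, Real.norm_eq_abs,
      abs_sub_comm, abs_of_pos (by linarith)]
    linarith
  refine ⟨?_, fun u hu hΦu => ?_⟩
  · refine wind_eq_of_norm_sub_lt ((hΦ.comp (continuous_circleLoop 0 r).continuousOn
        fun s _ => circleLoop_mem_closedBall hr0.le hr1.le s).sub continuousOn_const)
      (by rw [circleLoop_zero_eq])
      ⟨hΓc, fun s hs => sub_ne_zero.2 (hw s hs), by rw [circleLoop_zero_eq]⟩ fun s hs => ?_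
    calc ‖Φ (circleLoop 0 r s) - w - (Φ (circleLoop 0 1 s) - w)‖
        = ‖Φ (circleLoop 0 r s) - Φ (circleLoop 0 1 s)‖ := by rw [sub_sub_sub_cancel_right]
      _ < m := hclose s
      _ ≤ _ := hmle s hs
  · obtain ⟨s, hs, rfl⟩ := ArgPrinciple.exists_circleLoop_eq hr0 hu
    have h := hclose s
    rw [hΦu, norm_sub_rev] at h
    exact not_lt.2 (hmle s hs) h

/-! ### Counting zeros: winding number one means exactly one zero -/

/-- **Winding number one forces exactly one zero.** If `H` is holomorphic on `‖z‖ < ρ`, has no zero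
on the circle `‖z‖ = r` (`0 < r < ρ`) and winds once along it, then `H` has exactly one zero in
the closed disc `‖z‖ ≤ r`, and it lies in the open disc (the total multiplicity of the zeros inside
is the winding number). [cite: Conway1978, Ch. V Thm 3.4 (argument principle)] -/
theorem exists_unique_zero_of_wind_eq_one (H : ℂ → ℂ) {ρ r : ℝ} (hr : 0 < r) (hrρ : r < ρ)
    (hH : DifferentiableOn ℂ H (ball 0 ρ)) (hsph : ∀ u : ℂ, ‖u‖ = r → H u ≠ 0)
    (hw : wind (fun t => H (circleLoop 0 r t)) = 1) :
    ∃ z₀ : ℂ, ‖z₀‖ < r ∧ H z₀ = 0 ∧ ∀ z : ℂ, ‖z‖ ≤ r → H z = 0 → z = z₀ := by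
  classical
  obtain ⟨S, n, g, hS, hg, hg0, hHPg⟩ := ArgPrinciple.factorisation H hr hrρ hH hsph
  have hsum := ArgPrinciple.wind_eq_sum hr S n (fun u hu => (hS u hu).1) hg hg0 hHPg
  rw [hw] at hsum
  -- `S` is a singleton `{u₀}` (every exponent is `≥ 1` and they sum to `1`)
  obtain ⟨u₀, hu₀⟩ : S.Nonempty := Finset.nonempty_iff_ne_empty.2 (by rintro rfl; simp at hsum)
  have hS1 : ∀ u ∈ S, u = u₀ := by
    intro u hu
    by_contra hne
    have hsub : ({u, u₀} : Finset ℂ) ⊆ S := by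
      intro v hv
      rw [Finset.mem_insert, Finset.mem_singleton] at hv
      rcases hv with rfl | rfl <;> assumption
    have h2 := Finset.sum_le_sum_of_subset_of_nonneg (f := fun v => (n v : ℤ)) hsub
      fun v _ _ => by positivity
    rw [Finset.sum_pair hne] at h2
    linarith [(hS u hu).2, (hS u₀ hu₀).2]
  have hn₀ : n u₀ ≠ 0 := by have := (hS u₀ hu₀).2; omega
  refine ⟨u₀, (hS u₀ hu₀).1, ?_, fun z hz hz0 => ?_⟩
  · rw [hHPg u₀ (mem_closedBall_zero_iff.2 (hS u₀ hu₀).1.le),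
      Finset.prod_eq_zero hu₀ (by rw [sub_self, zero_pow hn₀]), zero_mul]
  · have h := hHPg z (mem_closedBall_zero_iff.2 hz)
    rw [hz0] at h
    have hP0 := (mul_eq_zero.mp h.symm).resolve_right (hg0 z (mem_closedBall_zero_iff.2 hz))
    obtain ⟨u, huS, hu0⟩ := Finset.prod_eq_zero_iff.mp hP0
    have hn : n u ≠ 0 := by have := (hS u huS).2; omega
    rw [pow_eq_zero_iff hn, sub_eq_zero] at hu0
    rw [hu0]
    exact hS1 u huS

/-- **Zeros inside from the winding of the boundary trace.** Let `Φ` be holomorphic on the unit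
disc and continuous on the closed disc, with boundary values omitting `w`. If the boundary loop
`s ↦ Φ(e^{2πis}) - w` has winding number `0`, then `Φ ≠ w` on the disc; if it has winding number
`1`, then `Φ` takes the value `w` at exactly one point of the disc.
[cite: Conway1978, Ch. V Thm 3.4 (argument principle)] -/
theorem zeros_of_boundary_wind {Φ : ℂ → ℂ} (hd : DifferentiableOn ℂ Φ (ball (0 : ℂ) 1))
    (hc : ContinuousOn Φ (closedBall (0 : ℂ) 1)) {w : ℂ}
    (hw : ∀ s ∈ Icc (0 : ℝ) 1, Φ (circleLoop 0 1 s) ≠ w) :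
    (wind (fun s => Φ (circleLoop 0 1 s) - w) = 0 → ∀ z ∈ ball (0 : ℂ) 1, Φ z ≠ w) ∧
    (wind (fun s => Φ (circleLoop 0 1 s) - w) = 1 →
      ∃ z₀ ∈ ball (0 : ℂ) 1, Φ z₀ = w ∧ ∀ z ∈ ball (0 : ℂ) 1, Φ z = w → z = z₀) := by
  obtain ⟨r₀, hr₀, hR⟩ := exists_radius_wind_eq hc hw
  have hdH : DifferentiableOn ℂ (fun z => Φ z - w) (ball 0 1) := hd.sub_const w
  -- radii between `max r₀ a` and `1`
  have hrad : ∀ a : ℝ, 0 ≤ a → a < 1 → ∃ r, r₀ < r ∧ a < r ∧ r < 1 ∧ 0 < r := fun a ha0 ha1 => by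
    refine ⟨(max r₀ a + 1) / 2, ?_, ?_, ?_, ?_⟩ <;>
      linarith [le_max_left r₀ a, le_max_right r₀ a, max_lt hr₀.2 ha1]
  -- exactly one zero in `‖z‖ ≤ r` when the winding number is `1`
  have hC : wind (fun s => Φ (circleLoop 0 1 s) - w) = 1 → ∀ r, r₀ < r → r < 1 → 0 < r →
      ∃ z₀, ‖z₀‖ < r ∧ Φ z₀ = w ∧ ∀ z, ‖z‖ ≤ r → Φ z = w → z = z₀ := by
    intro h1 r h1r hr1 hr0
    obtain ⟨hwr, hsph⟩ := hR r ⟨h1r, hr1⟩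
    obtain ⟨z₀, hz₀, hz₀w, huniq⟩ := exists_unique_zero_of_wind_eq_one (fun z => Φ z - w) hr0 hr1
      hdH (fun u hu => sub_ne_zero.2 (hsph u hu)) (by rw [hwr, h1])
    exact ⟨z₀, hz₀, sub_eq_zero.1 hz₀w, fun z hz hzw => huniq z hz (sub_eq_zero.2 hzw)⟩
  constructor
  · intro h0 z hz hzw
    rw [mem_ball_zero_iff] at hz
    obtain ⟨r, h1, h2, h3, h4⟩ := hrad ‖z‖ (norm_nonneg z) hz
    obtain ⟨hwr, hsph⟩ := hR r ⟨h1, h3⟩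
    have hpos : 0 < wind (fun s => Φ (circleLoop 0 r s) - w) :=
      wind_circleLoop_pos_of_zero (fun z => Φ z - w) h4 h3 hdH h2 (sub_eq_zero.2 hzw)
        fun u hu => sub_ne_zero.2 (hsph u hu)
    rw [hwr, h0] at hpos
    exact lt_irrefl _ hpos
  · intro h1
    obtain ⟨r₁, h11, -, h13, h14⟩ := hrad 0 le_rfl one_pos
    obtain ⟨z₀, hz₀, hz₀w, -⟩ := hC h1 r₁ h11 h13 h14
    refine ⟨z₀, mem_ball_zero_iff.2 (hz₀.trans h13), hz₀w, fun z hz hzw => ?_⟩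
    rw [mem_ball_zero_iff] at hz
    obtain ⟨r, h21, h22, h23, h24⟩ :=
      hrad (max ‖z‖ ‖z₀‖) (by positivity) (max_lt hz (hz₀.trans h13))
    obtain ⟨z₁, -, -, huniq⟩ := hC h1 r h21 h23 h24
    rw [huniq z ((le_max_left _ _).trans h22.le) hzw,
      huniq z₀ ((le_max_right _ _).trans h22.le) hz₀w]

/-! ### Winding numbers of a loop on the frontier of a convex set -/

/-- **A loop on the frontier of a convex set winds equally about all interior points** (the
winding number is constant on the connected set `interior K`, which misses the loop).
[folklore] -/
theorem wind_sub_eq_of_mem_interior {Γ : ℝ → ℂ} (hΓ : ContinuousOn Γ (Icc 0 1))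
    (h01 : Γ 0 = Γ 1) {K : Set ℂ} (hK : Convex ℝ K)
    (hΓK : ∀ s ∈ Icc (0 : ℝ) 1, Γ s ∈ frontier K) {w₀ w : ℂ} (hw₀ : w₀ ∈ interior K)
    (hw : w ∈ interior K) : wind (fun s => Γ s - w) = wind (fun s => Γ s - w₀) := by
  have hsub : interior K ⊆ (frontier K)ᶜ := fun x hx hxf =>
    Set.disjoint_left.1 disjoint_interior_frontier hx hxf
  exact wind_sub_eq_of_mem_connectedComponentIn hΓ h01 isClosed_frontier (fun s hs => hΓK s hs)
    (hK.interior.isPreconnected.subset_connectedComponentIn hw hsub hw₀)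

/-- **A loop inside a closed convex set does not wind about points off the set**: escape to
infinity along the ray from the point away from the set, which misses the set by convexity.
[folklore] -/
theorem wind_sub_eq_zero_of_not_mem {Γ : ℝ → ℂ} (hΓ : ContinuousOn Γ (Icc 0 1))
    (h01 : Γ 0 = Γ 1) {K : Set ℂ} (hK : Convex ℝ K)
    (hΓK : ∀ s ∈ Icc (0 : ℝ) 1, Γ s ∈ K) {w : ℂ} (hw : w ∉ K) : wind (fun s => Γ s - w) = 0 := by
  -- a point of `K` and the escape ray `w + t (w - a)`, `t ≥ 0`
  set a : ℂ := Γ 0 with ha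
  have haK : a ∈ K := hΓK 0 ⟨le_rfl, zero_le_one⟩
  have hwa : w - a ≠ 0 := sub_ne_zero.2 fun h => hw (h ▸ haK)
  set R : Set ℂ := (fun t : ℝ => w + (t : ℂ) * (w - a)) '' Ici 0 with hR
  have hRK : ∀ p ∈ R, p ∉ K := by
    rintro p ⟨t, ht, rfl⟩ hp
    have h1t : (0 : ℝ) < 1 + t := by linarith [mem_Ici.1 ht]
    have h1t' : (1 + (t : ℂ)) ≠ 0 := by exact_mod_cast h1t.ne'
    have key : (t / (1 + t)) • a + (1 / (1 + t)) • (w + (t : ℂ) * (w - a)) = w := by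
      simp only [Complex.real_smul]; push_cast; field_simp; ring
    refine hw ?_
    rw [← key]
    exact hK haK hp (div_nonneg (mem_Ici.1 ht) h1t.le) (div_nonneg zero_le_one h1t.le)
      (by field_simp; ring)
  have hRpc : IsPreconnected R := isPreconnected_Ici.image _
    (by fun_prop : Continuous fun t : ℝ => w + (t : ℂ) * (w - a)).continuousOn
  have hwR : w ∈ R := ⟨0, self_mem_Ici, by simp⟩
  -- a far point on the ray
  obtain ⟨C, hC⟩ := isCompact_Icc.exists_bound_of_continuousOn (f := fun s => Γ s - w)
    (hΓ.sub continuousOn_const)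
  set T : ℝ := (max C 0 + 1) / ‖w - a‖ with hT
  have hT0 : 0 ≤ T := div_nonneg (by positivity) (norm_nonneg _)
  have hpR : w + (T : ℂ) * (w - a) ∈ R := ⟨T, mem_Ici.2 hT0, rfl⟩
  have hp0 : wind (fun s => Γ s - (w + (T : ℂ) * (w - a))) = 0 := by
    refine wind_sub_eq_zero_of_norm_sub_lt hΓ h01 (c := w) fun s hs => ?_
    rw [add_sub_cancel_left, norm_mul, norm_real, Real.norm_eq_abs, abs_of_nonneg hT0, hT,
      div_mul_cancel₀ _ (norm_ne_zero_iff.2 hwa)]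
    linarith [hC s hs, le_max_left C 0]
  exact wind_sub_eq_zero_of_mem_closure hΓ h01 hRpc (fun s hs h => hRK _ h (hΓK s hs))
    (subset_closure hwR) (fun s hs h => hw (h ▸ hΓK s hs)) hpR hp0

/-! ### The two theorems -/

/-- **A holomorphic boundary trace never winds negatively.** For `Φ` holomorphic on the unit disc
and continuous on the closed disc, and a continuous argument `θ` of `Φ(e^{it}) - w₀` on `[0, 2π]`
(`w₀` omitted by the boundary values), `θ(0) ≤ θ(2π)`: indeed
`θ(2π) - θ(0) = 2π · #{zeros of Φ - w₀ in the disc} ≥ 0`.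
[cite: Conway1978, Ch. V Thm 3.4 (argument principle)] -/
theorem traceWinding_nonneg (Φ : ℂ → ℂ) (w₀ : ℂ) (θ : ℝ → ℝ)
    (hd : DifferentiableOn ℂ Φ (ball (0 : ℂ) 1)) (hc : ContinuousOn Φ (closedBall (0 : ℂ) 1))
    (hθ : ContinuousOn θ (Icc (0 : ℝ) (2 * π)))
    (hb : ∀ t ∈ Icc (0 : ℝ) (2 * π), Φ (exp (t * I)) ≠ w₀ ∧
      Φ (exp (t * I)) - w₀ = (‖Φ (exp (t * I)) - w₀‖ : ℂ) * exp (θ t * I)) :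
    θ 0 ≤ θ (2 * π) := by
  have hA := sub_eq_two_pi_mul_wind hc hθ (fun t ht => (hb t ht).1) fun t ht => (hb t ht).2
  have hw : ∀ s ∈ Icc (0 : ℝ) 1, Φ (circleLoop 0 1 s) ≠ w₀ := fun s hs => by
    rw [circleLoop_zero_one]; exact (hb _ (two_pi_mul_mem_Icc hs)).1
  obtain ⟨r₀, hr₀, hR⟩ := exists_radius_wind_eq hc hw
  obtain ⟨hwr, hsph⟩ := hR ((r₀ + 1) / 2) ⟨by linarith [hr₀.2], by linarith [hr₀.2]⟩
  have hnn : 0 ≤ wind (fun s => Φ (circleLoop 0 ((r₀ + 1) / 2) s) - w₀) :=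
    wind_circleLoop_nonneg (fun z => Φ z - w₀) (by linarith [hr₀.1]) (by linarith [hr₀.2])
      (hd.sub_const w₀) fun u hu => sub_ne_zero.2 (hsph u hu)
  rw [hwr] at hnn
  have : (0 : ℝ) ≤ 2 * π * (wind (fun s => Φ (circleLoop 0 1 s) - w₀) : ℝ) :=
    mul_nonneg Real.two_pi_pos.le (by exact_mod_cast hnn)
  linarith

/-- **Darboux's theorem, convex-target form.** Let `Φ` be holomorphic on the unit disc and
continuous on the closed disc, `K` compact convex and `w₀ ∈ interior K`. If the boundary values
`Φ(e^{it})`, `t ∈ [0, 2π]`, lie on `frontier K` and `Φ(e^{it}) - w₀ = ‖Φ(e^{it}) - w₀‖ e^{iθ(t)}`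
for a continuous `θ` with `θ(2π) = θ(0) + 2π` (the trace winds once about `w₀`), then `Φ` is
injective on the disc and `Φ(disc) = interior K`. [cite: Boas2010, §13D (Darboux's theorem)] -/
theorem darbouxPicard_convex (Φ : ℂ → ℂ) (K : Set ℂ) (w₀ : ℂ) (θ : ℝ → ℝ)
    (hK : Convex ℝ K) (hKc : IsCompact K) (hw₀ : w₀ ∈ interior K)
    (hd : DifferentiableOn ℂ Φ (ball (0 : ℂ) 1)) (hc : ContinuousOn Φ (closedBall (0 : ℂ) 1))
    (hθ : ContinuousOn θ (Icc (0 : ℝ) (2 * π))) (h2π : θ (2 * π) = θ 0 + 2 * π)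
    (hb : ∀ t ∈ Icc (0 : ℝ) (2 * π), Φ (exp (t * I)) ∈ frontier K ∧
      Φ (exp (t * I)) - w₀ = (‖Φ (exp (t * I)) - w₀‖ : ℂ) * exp (θ t * I)) :
    InjOn Φ (ball (0 : ℂ) 1) ∧ Φ '' ball (0 : ℂ) 1 = interior K := by
  -- the boundary loop `Γ s = Φ (e^{2πis})`
  have hΓc : ContinuousOn (fun s : ℝ => Φ (circleLoop 0 1 s)) (Icc 0 1) :=
    hc.comp (continuous_circleLoop 0 1).continuousOn
      fun s _ => circleLoop_mem_closedBall zero_le_one le_rfl s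
  have hΓ01 : Φ (circleLoop 0 1 0) = Φ (circleLoop 0 1 1) := by rw [circleLoop_zero_eq]
  have hΓfr : ∀ s ∈ Icc (0 : ℝ) 1, Φ (circleLoop 0 1 s) ∈ frontier K := fun s hs => by
    rw [circleLoop_zero_one]; exact (hb _ (two_pi_mul_mem_Icc hs)).1
  have hfrK : frontier K ⊆ K := hKc.isClosed.frontier_subset
  have hΓK : ∀ s ∈ Icc (0 : ℝ) 1, Φ (circleLoop 0 1 s) ∈ K := fun s hs => hfrK (hΓfr s hs)
  have hdisj : ∀ x ∈ interior K, x ∉ frontier K := fun x hx hxf =>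
    Set.disjoint_left.1 disjoint_interior_frontier hx hxf
  -- winding number one about `w₀`, hence about every interior point; zero off `K`
  have hne₀ : ∀ t ∈ Icc (0 : ℝ) (2 * π), Φ (exp (t * I)) ≠ w₀ := fun t ht h =>
    hdisj w₀ hw₀ (h ▸ (hb t ht).1)
  have hA := sub_eq_two_pi_mul_wind hc hθ hne₀ fun t ht => (hb t ht).2
  have hw₀1 : wind (fun s => Φ (circleLoop 0 1 s) - w₀) = 1 := by
    have h : 2 * π * (wind (fun s => Φ (circleLoop 0 1 s) - w₀) : ℝ) = 2 * π * 1 := by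
      rw [← hA]
      linarith
    exact_mod_cast mul_left_cancel₀ Real.two_pi_pos.ne' h
  have hint : ∀ w ∈ interior K, wind (fun s => Φ (circleLoop 0 1 s) - w) = 1 := fun w hw =>
    (wind_sub_eq_of_mem_interior hΓc hΓ01 hK hΓfr hw₀ hw).trans hw₀1
  have hout : ∀ w ∉ K, wind (fun s => Φ (circleLoop 0 1 s) - w) = 0 := fun w hw =>
    wind_sub_eq_zero_of_not_mem hΓc hΓ01 hK hΓK hw
  -- zero counts
  have hpre : ∀ w ∈ interior K,
      ∃ z₀ ∈ ball (0 : ℂ) 1, Φ z₀ = w ∧ ∀ z ∈ ball (0 : ℂ) 1, Φ z = w → z = z₀ := fun w hw =>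
    (zeros_of_boundary_wind hd hc (w := w) fun s hs h => hdisj w hw (h ▸ hΓfr s hs)).2 (hint w hw)
  have himK : ∀ z ∈ ball (0 : ℂ) 1, Φ z ∈ K := fun z hz => by
    by_contra hzK
    exact (zeros_of_boundary_wind hd hc (w := Φ z) fun s hs h => hzK (h ▸ hΓK s hs)).1
      (hout _ hzK) z hz rfl
  -- the open mapping theorem: `Φ(disc)` is open, hence inside `interior K`
  have han : AnalyticOnNhd ℂ Φ (ball 0 1) := hd.analyticOnNhd isOpen_ball
  have hopen : IsOpen (Φ '' ball (0 : ℂ) 1) := by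
    rcases han.is_constant_or_isOpen (convex_ball (0 : ℂ) 1).isPreconnected with ⟨c, hc'⟩ | h
    · exfalso
      obtain ⟨ε, hε, hεK⟩ := Metric.isOpen_iff.1 isOpen_interior w₀ hw₀
      have hw₁ : w₀ + ((ε / 2 : ℝ) : ℂ) ∈ interior K := hεK (by
        rw [mem_ball, dist_eq_norm, add_sub_cancel_left, norm_real, Real.norm_eq_abs,
          abs_of_pos (by positivity)]
        linarith)
      obtain ⟨z, hz, hzw, -⟩ := hpre w₀ hw₀
      obtain ⟨z', hz', hz'w, -⟩ := hpre _ hw₁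
      have h1 : w₀ + ((ε / 2 : ℝ) : ℂ) = w₀ :=
        calc w₀ + ((ε / 2 : ℝ) : ℂ) = Φ z' := hz'w.symm
          _ = c := hc' z' hz'
          _ = Φ z := (hc' z hz).symm
          _ = w₀ := hzw
      have h2 : (ε / 2 : ℝ) = 0 := by exact_mod_cast add_eq_left.1 h1
      linarith
    · exact h _ Subset.rfl isOpen_ball
  have hsub : Φ '' ball (0 : ℂ) 1 ⊆ interior K := interior_maximal (image_subset_iff.2 himK) hopen
  refine ⟨fun z₁ hz₁ z₂ hz₂ heq => ?_, hsub.antisymm fun w hw => ?_⟩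
  · obtain ⟨z₀, -, -, huniq⟩ := hpre (Φ z₂) (hsub ⟨z₂, hz₂, rfl⟩)
    exact (huniq z₁ hz₁ heq).trans (huniq z₂ hz₂ rfl).symm
  · obtain ⟨z, hz, hzw, -⟩ := hpre w hw
    exact ⟨z, hz, hzw⟩

end Literature.Analysis.Complex

end
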